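import Literature.Topology.FourManifolds.HandleChartMap
import Literature.Topology.FourManifolds.FlowLevelBounds
import HarnessLib

/-!
# The handle-extension map: conjugating two flows through a handle

Topic `Literature/Topology/FourManifolds` (fact seat
`provefact-Literature.Topology.FourManifolds.IsHandlebody.exists_isBoundaryGluing_sphere`, step F2b of
the Lickorish–Wallace DAG; the core of the handle-extension step — uniqueness of attaching one
`1`-handle — of the classification of handlebodies).  Everything here is **proved**; no named
facts.

Milnor, *Lectures on the h-cobordism theorem* (1965), proof of Thm. 3.13 (PDF pp. 18–19)
compares a manifold `W` above a critical level with `ω(V) ∪ H` by the integral curves of the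
normalised gradient-like field and by the Milnor coordinates of the handle `H`.  We use the
same two devices to compare **two** manifolds `M`, `M'` carrying functions `f`, `f'`, each with
one critical point `p`, `p'` of the same index above the levels `a`, `a' = a + σ`, given a
correspondence `low : M → M'` of the parts below (and slightly above) those levels which
conjugates the flows near the levels and agrees with the chart map on the feet of the handle:

* `Literature.Topology.FourManifolds.HandleSide` — the data on one manifold: `f`, the field
  `X` with a handle chart `D` at `p` (`HandleChartField.lean`) and unit speed on a slab off the
  core (`HandleStageField.lean`), its smooth global flow `θ`, the handle region
  `N = D.region ε γ (a - η/4) ℓ⁺` (`HandleRegion.lean`) and the parameters with their inequalities;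
* `Literature.Topology.FourManifolds.HandlePair` — two sides with the same model (`k, r, ε, γ`),
  the level offset `σ = f' p' - f p`, the maps `low`, `low'` inverse to each other with the
  level, flow and feet compatibilities; `HandlePair.swap`;
* `HandlePair.hetMap` — **the handle-extension map**: the chart map `φ̂'⁻¹ ∘ φ̂` on `N`
  (`HandleChartMap.lean`), `low` below the level `a + η/2`, and the flow conjugation
  `Λ x = θ' (f x - a, low (θ (a - f x, x)))` elsewhere.

This file proves the orbit correspondences on which everything rests: orbits from the feet stay
in the region and are conjugated by the chart map (`chartMap_flow_of_mem_feet`), `low` carries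
feet to feet and non-feet to non-feet (`low_mem_feet_iff`), the foot of a point outside the
region (`foot`, by backward flow at unit speed, `HandleBackwardFlow.lean`) is not a foot of the
handle, and the image of such a point under `Λ` lies outside the region of `M'` with the shifted
level (`lam_not_mem_region`, `apply_lam`).

## References

* J. Milnor, *Lectures on the h-cobordism theorem* (1965), Def. 3.1, proofs of Thm. 3.4 (PDF
  p. 13) and Thm. 3.13 (PDF pp. 18–19). [MilnorHCobordism1965]
* A. Kosinski, *Differential Manifolds* (1993), VI §7, VII §2. [Kosinski1993]
-/

open scoped Manifold ContDiff Topology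
open Set Function Filter Metric

noncomputable section

namespace Literature.Topology.FourManifolds

universe u

variable {m : ℕ} {H : Type*} [TopologicalSpace H] (J : ModelWithCorners ℝ (EuclideanSpace ℝ (Fin m)) H)
  (M : Type u) [TopologicalSpace M] [ChartedSpace H M] [IsManifold J ∞ M]
  (M' : Type u) [TopologicalSpace M'] [ChartedSpace H M'] [IsManifold J ∞ M']

/-- Local notation: `𝔼 m` is the model Euclidean space `EuclideanSpace ℝ (Fin m)`. -/
local notation "𝔼 " m:arg => EuclideanSpace ℝ (Fin m)

/-- **The data of the handle-extension step on one manifold.**  A smooth function `f`, a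
vector field `X` with a handle chart `D` at the critical point `p` and its smooth global flow `θ`;
parameters: the box size `ε`, the region constant `γ`, the collar width `η`, the cut level `a`
(below the critical value `f p`), the unit-speed slab `[ℓ₁, ℓ₂]`, the top `ℓ⁺` of the region and
the margin `δ`; and the hypotheses: the closed chart ball of radius `3ε` in the chart target,
`X(f) = 1` on the slab off the core and `X(f) ∈ [0, 1]` on the slab, the regions closed, the core
inside the half-constant region and above the level `a - η/4`, the region off the walls of the
box, and the order of the levels. [cite: MilnorHCobordism1965, Def. 3.1 and proof of Thm. 3.13] -/
structure HandleSide where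
  /-- The Morse function. -/
  f : M → ℝ
  /-- The field. -/
  X : Π x : M, TangentSpace J x
  /-- Its global flow. -/
  θ : ℝ × M → M
  /-- The critical point. -/
  p : M
  /-- The handle chart. -/
  D : HandleChart J f X p
  hf : ContMDiff J 𝓘(ℝ, ℝ) ∞ f
  hX : ContMDiff J J.tangent ∞ fun x => (⟨x, X x⟩ : TangentBundle J M)
  flow : IsSmoothFlow J X θ
  /-- Box size. -/
  ε : ℝ
  /-- Region constant. -/
  γ : ℝ
  /-- Collar width. -/
  η : ℝ
  /-- Cut level. -/
  a : ℝ
  /-- Bottom of the unit-speed slab. -/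
  ℓ₁ : ℝ
  /-- Top of the unit-speed slab. -/
  ℓ₂ : ℝ
  /-- Top of the region. -/
  ℓu : ℝ
  /-- Margin. -/
  δ : ℝ
  ε_pos : 0 < ε
  γ_pos : 0 < γ
  η_pos : 0 < η
  δ_pos : 0 < δ
  hball : closedBall (D.chart.extend J p) (3 * ε) ⊆ (D.chart.extend J).target
  hunit : ∀ x, f x ∈ Icc ℓ₁ ℓ₂ → x ∉ D.core → mlineDeriv J f x (X x) = 1
  hspeed : ∀ x, f x ∈ Icc ℓ₁ ℓ₂ → mlineDeriv J f x (X x) ∈ Icc (0 : ℝ) 1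
  isClosed_region : IsClosed (D.region ε γ (a - η / 4) ℓu)
  isClosed_region_half : IsClosed (D.region ε (γ / 2) (a - η / 4) ℓu)
  isClosed_region_small : IsClosed (D.region ε (γ / 2) a (ℓu - δ))
  core_subset : D.core ⊆ D.region ε (γ / 2) (a - η / 4) ℓu
  lt_of_mem_core : ∀ q ∈ D.core, a - η / 4 < f q
  hlow : f p - ε ^ 2 + γ / ε ^ 2 < a - η / 4
  hhigh : ℓu < f p + 4 * ε ^ 2 - γ / (4 * ε ^ 2)
  hℓ₁ : ℓ₁ < a - (ℓu - a) - η
  ha : a + η < ℓu - δ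
  hℓu : ℓu < ℓ₂

namespace HandleSide

variable {J M} (S : HandleSide J M)

/-- The handle region `N = D.region ε γ (a - η/4) ℓ⁺`. [cite: MilnorHCobordism1965, proof of Thm. 3.13 (PDF p. 18)] -/
def N : Set M := S.D.region S.ε S.γ (S.a - S.η / 4) S.ℓu

/-- The half-constant region `N₁ = D.region ε (γ/2) (a - η/4) ℓ⁺ ⊆ N`. [folklore] -/
def N₁ : Set M := S.D.region S.ε (S.γ / 2) (S.a - S.η / 4) S.ℓu

/-- The feet `F = N ∩ f⁻¹(a)`. [cite: MilnorHCobordism1965, proof of Thm. 3.13 (PDF p. 18)] -/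
def feet : Set M := {y | y ∈ S.N ∧ S.f y = S.a}

/-- (Bookkeeping.) [folklore] -/
theorem N₁_subset_N : S.N₁ ⊆ S.N := fun q hq =>
  ⟨hq.1, hq.2.1, hq.2.2.1, hq.2.2.2.1.trans (by linarith [S.γ_pos]), hq.2.2.2.2⟩

/-- (Bookkeeping.) [folklore] -/
theorem core_subset_N : S.D.core ⊆ S.N := S.core_subset.trans S.N₁_subset_N

/-- (Bookkeeping.) [folklore] -/
theorem isFlowOf : IsFlowOf J S.X S.θ := S.flow.isFlowOf

/-- (Bookkeeping.) [folklore] -/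
theorem a_lt_ℓu : S.a < S.ℓu := by linarith [S.ha, S.η_pos, S.δ_pos]

/-- (Bookkeeping.) [folklore] -/
theorem ℓ₁_lt_a : S.ℓ₁ < S.a - S.η := by linarith [S.hℓ₁, S.a_lt_ℓu]

/-- Points of the region lie in the chart ball of radius `3ε`. [folklore] -/
theorem N_subset_cball : S.N ⊆ S.D.cball (3 * S.ε) := by
  intro q hq
  refine ⟨hq.1, ?_⟩
  have h1 : ‖S.D.coord q‖ ^ 2 < 5 * S.ε ^ 2 := by
    rw [← sqSumLT_add_sqSumGE S.D.k (S.D.coord q)]; linarith [hq.2.1, hq.2.2.1]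
  nlinarith [norm_nonneg (S.D.coord q), S.ε_pos]

/-! ### Orbits and the region -/

/-- **Backward flow at unit speed off the region** (`HandleBackwardFlow.lean` with the trap
region `N₁ ⊇ core`): for `x ∉ N₁` with `f x ≤ ℓ⁺` and `0 ≤ T ≤ f x - a + 2η`... precisely
`ℓ₁ < f x - T`: `f (θ (-s, x)) = f x - s` and `θ (-s, x) ∉ core` for `s ∈ [0, T]`.
[cite: MilnorHCobordism1965, proof of Thm. 3.4 (PDF p. 13)] -/
theorem apply_neg_eq_sub {x : M} (hx : x ∉ S.N₁) (hxu : S.f x ≤ S.ℓu) {T : ℝ} (hT : 0 ≤ T)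
    (hT₁ : S.ℓ₁ < S.f x - T) {s : ℝ} (hs : s ∈ Icc 0 T) :
    S.f (S.θ (-s, x)) = S.f x - s ∧ S.θ (-s, x) ∉ S.D.core :=
  S.isFlowOf.apply_neg_eq_sub S.D S.hf S.hunit S.isClosed_region_half S.core_subset S.lt_of_mem_core
    S.hℓu hx hxu hT hT₁ hs

/-- **Levels along forward orbits**: `f z ≤ f (θ (t, z)) ≤ f z + t` (speed in `[0, 1]`), for
`ℓ₁ < f z`, `f z + T < ℓ₂`, `t ∈ [0, T]`. [cite: MilnorHCobordism1965, proof of Thm. 3.4 (PDF p. 13)] -/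
theorem apply_mem_Icc {z : M} (hz : S.ℓ₁ < S.f z) {T : ℝ} (hT : S.f z + T < S.ℓ₂) {t : ℝ}
    (ht : t ∈ Icc 0 T) : S.f z ≤ S.f (S.θ (t, z)) ∧ S.f (S.θ (t, z)) ≤ S.f z + t :=
  S.isFlowOf.apply_mem_Icc_of_speed_mem S.hf S.hspeed hz hT ht

/-- **Invariance of the region along orbit segments whose levels stay in `[a - η/4, ℓ⁺]`.**
[cite: MilnorHCobordism1965, proof of Thm. 3.13 (PDF p. 18)] -/
theorem mem_N_iff {z : M} {t₁ t₂ : ℝ} (hlev : ∀ t ∈ Icc t₁ t₂, S.f (S.θ (t, z)) ∈ Icc (S.a - S.η / 4) S.ℓu)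
    {t t' : ℝ} (ht : t ∈ Icc t₁ t₂) (ht' : t' ∈ Icc t₁ t₂) : S.θ (t, z) ∈ S.N ↔ S.θ (t', z) ∈ S.N :=
  S.isFlowOf.mem_region_iff_of_forall_apply_mem S.D S.isClosed_region hlev ht ht'

/-- **Orbits from the feet stay in the region**: for `y ∈ F` and `0 ≤ t ≤ ℓ⁺ - a`,
`θ (t, y) ∈ N`. [cite: MilnorHCobordism1965, proof of Thm. 3.13 (PDF p. 18)] -/
theorem flow_mem_N_of_mem_feet {y : M} (hy : y ∈ S.feet) {t : ℝ} (ht : t ∈ Icc 0 (S.ℓu - S.a)) :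
    S.θ (t, y) ∈ S.N := by
  have hya : S.f y = S.a := hy.2
  have hlev : ∀ τ ∈ Icc 0 (S.ℓu - S.a), S.f (S.θ (τ, y)) ∈ Icc (S.a - S.η / 4) S.ℓu := by
    intro τ hτ
    have h := S.apply_mem_Icc (z := y) (by rw [hya]; linarith [S.ℓ₁_lt_a, S.η_pos])
      (T := S.ℓu - S.a) (by rw [hya]; linarith [S.hℓu]) hτ
    rw [hya] at h
    exact ⟨by linarith [h.1, S.η_pos], by linarith [h.2, hτ.2]⟩
  have hiff := S.mem_N_iff hlev ht (left_mem_Icc.2 (by linarith [S.a_lt_ℓu]))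
  rw [S.isFlowOf.map_zero] at hiff
  exact hiff.2 hy.1

/-- **The foot of a point outside the region.**  For `x ∉ N` with `a ≤ f x ≤ ℓ⁺`: the backward
orbit reaches the level `a` at time `f x - a` at a point `foot x = θ (a - f x, x)` with
`f (foot x) = a`, which is not a foot of the handle (`foot x ∉ F`, indeed `∉ N`).
[cite: MilnorHCobordism1965, proof of Thm. 3.13 (PDF p. 18)] -/
theorem apply_foot_and_not_mem {x : M} (hx : x ∉ S.N) (hxa : S.a ≤ S.f x) (hxu : S.f x ≤ S.ℓu) :
    S.f (S.θ (S.a - S.f x, x)) = S.a ∧ S.θ (S.a - S.f x, x) ∉ S.N := by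
  have hx₁ : x ∉ S.N₁ := fun h => hx (S.N₁_subset_N h)
  have hT₁ : S.ℓ₁ < S.f x - (S.f x - S.a) := by linarith [S.ℓ₁_lt_a, S.η_pos]
  have hlev : ∀ s ∈ Icc 0 (S.f x - S.a), S.f (S.θ (-s, x)) = S.f x - s := fun s hs =>
    (S.apply_neg_eq_sub hx₁ hxu (by linarith) hT₁ hs).1
  have h1 := hlev (S.f x - S.a) ⟨by linarith, le_rfl⟩
  rw [show -(S.f x - S.a) = S.a - S.f x by ring] at h1
  refine ⟨by rw [h1]; ring, fun hmem => hx ?_⟩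
  -- invariance of `N` along the backward orbit
  have hband : ∀ t ∈ Icc (S.a - S.f x) 0, S.f (S.θ (t, x)) ∈ Icc (S.a - S.η / 4) S.ℓu := by
    intro t ht
    have h2 := hlev (-t) ⟨by linarith [ht.2], by linarith [ht.1]⟩
    rw [neg_neg] at h2
    rw [h2]; constructor <;> linarith [ht.1, ht.2, S.η_pos]
  have hiff := S.mem_N_iff hband (t := S.a - S.f x) (t' := 0) ⟨le_rfl, by linarith⟩ ⟨by linarith, le_rfl⟩
  rw [S.isFlowOf.map_zero] at hiff
  exact hiff.1 hmem

/-! ### The small region and the interior of the region -/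

/-- The small region `D.region ε (γ/2) a (ℓ⁺ - δ)`, inside the interior of `N`. [folklore] -/
def Nsm : Set M := S.D.region S.ε (S.γ / 2) S.a (S.ℓu - S.δ)

/-- An open part of `N` containing the small region. [folklore] -/
def Nint : Set M :=
  {q | q ∈ S.D.chart.source ∧ sqSumLT S.D.k (S.D.coord q) < S.ε ^ 2 ∧ sqSumGE S.D.k (S.D.coord q) < 4 * S.ε ^ 2 ∧
    sqSumLT S.D.k (S.D.coord q) * sqSumGE S.D.k (S.D.coord q) < S.γ ∧ S.f q ∈ Ioo (S.a - S.η / 4) S.ℓu}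

/-- (Bookkeeping.) [folklore] -/
theorem Nsm_subset_N₁ : S.Nsm ⊆ S.N₁ := fun _ hq =>
  ⟨hq.1, hq.2.1, hq.2.2.1, hq.2.2.2.1, ⟨by linarith [hq.2.2.2.2.1, S.η_pos], by linarith [hq.2.2.2.2.2, S.δ_pos]⟩⟩

/-- (Bookkeeping.) [folklore] -/
theorem Nsm_subset_Nint : S.Nsm ⊆ S.Nint := fun _ hq =>
  ⟨hq.1, hq.2.1, hq.2.2.1, by linarith [hq.2.2.2.1, S.γ_pos],
    ⟨by linarith [hq.2.2.2.2.1, S.η_pos], by linarith [hq.2.2.2.2.2, S.δ_pos]⟩⟩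

/-- (Bookkeeping.) [folklore] -/
theorem Nint_subset_N : S.Nint ⊆ S.N := fun _ hq =>
  ⟨hq.1, hq.2.1, hq.2.2.1, hq.2.2.2.1.le, ⟨hq.2.2.2.2.1.le, hq.2.2.2.2.2.le⟩⟩

/-- (Bookkeeping.) [folklore] -/
theorem isOpen_Nint : IsOpen S.Nint := by
  have h1 : IsOpen {v : 𝔼 m | sqSumLT S.D.k v < S.ε ^ 2 ∧ sqSumGE S.D.k v < 4 * S.ε ^ 2 ∧
      sqSumLT S.D.k v * sqSumGE S.D.k v < S.γ} :=
    (isOpen_lt (continuous_sqSumLT S.D.k) continuous_const).and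
      ((isOpen_lt (continuous_sqSumGE S.D.k) continuous_const).and
        (isOpen_lt ((continuous_sqSumLT S.D.k).mul (continuous_sqSumGE S.D.k)) continuous_const))
  have h2 := S.D.continuousOn_coord.isOpen_inter_preimage S.D.chart.open_source h1
  have h3 : IsOpen (S.f ⁻¹' Ioo (S.a - S.η / 4) S.ℓu) := isOpen_Ioo.preimage S.hf.continuous
  convert h2.inter h3 using 1
  ext q
  simp only [Nint, mem_setOf_eq, mem_inter_iff, mem_preimage]
  tauto

/-- Off the small region, a point with level in `(a, ℓ⁺ - δ)` is off `N₁`. [folklore] -/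
theorem not_mem_N₁_of_not_mem_Nsm {x : M} (hxs : x ∉ S.Nsm) (hxa : S.a < S.f x)
    (hxu : S.f x < S.ℓu - S.δ) : x ∉ S.N₁ := fun h₁ =>
  hxs ⟨h₁.1, h₁.2.1, h₁.2.2.1, h₁.2.2.2.1, ⟨hxa.le, hxu.le⟩⟩


end HandleSide

/-- **The data of the handle-extension step on a pair of manifolds**: two sides with the same
model (index, core radius, box size, region constant, collar width, margin), levels shifted by
`σ = f' p' - f p`, and the lower correspondence `low : M → M'`, `low' : M' → M`: smooth below
`a + η`, inverse to each other there, shifting levels by `σ` and conjugating the flows near the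
cut levels, and agreeing with the chart maps on the feet. [cite: MilnorHCobordism1965, proof of Thm. 3.13 (PDF pp. 18–19)] -/
structure HandlePair where
  /-- The first side. -/
  S : HandleSide J M
  /-- The second side. -/
  S' : HandleSide J M'
  hk : S.D.k = S'.D.k
  hr : S.D.r = S'.D.r
  hε : S'.ε = S.ε
  hγ : S'.γ = S.γ
  hη : S'.η = S.η
  hδ : S'.δ = S.δ
  ha : S'.a = S.a + (S'.f S'.p - S.f S.p)
  hℓ₁ : S'.ℓ₁ = S.ℓ₁ + (S'.f S'.p - S.f S.p)
  hℓ₂ : S'.ℓ₂ = S.ℓ₂ + (S'.f S'.p - S.f S.p)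
  hℓu : S'.ℓu = S.ℓu + (S'.f S'.p - S.f S.p)
  /-- The lower correspondence. -/
  low : M → M'
  /-- Its inverse. -/
  low' : M' → M
  low_smooth : ContMDiffOn J J ∞ low {x | S.f x < S.a + S.η}
  low'_smooth : ContMDiffOn J J ∞ low' {x | S'.f x < S'.a + S'.η}
  apply_low : ∀ x, S.f x ∈ Ioo (S.a - S.η / 2) (S.a + S.η / 2) → S'.f (low x) = S.f x + (S'.f S'.p - S.f S.p)
  apply_low' : ∀ x, S'.f x ∈ Ioo (S'.a - S'.η / 2) (S'.a + S'.η / 2) → S.f (low' x) = S'.f x + (S.f S.p - S'.f S'.p)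
  low_below : ∀ x, S.f x < S.a - S.η / 4 → S'.f (low x) < S'.a - S'.η / 4
  low'_below : ∀ x, S'.f x < S'.a - S'.η / 4 → S.f (low' x) < S.a - S.η / 4
  low'_low : ∀ x, S.f x < S.a + S.η / 2 → low' (low x) = x
  low_low' : ∀ x, S'.f x < S'.a + S'.η / 2 → low (low' x) = x
  low_flow : ∀ x t, S.f x ∈ Ioo (S.a - S.η / 2) (S.a + S.η / 2) →
    S.f x + t ∈ Ioo (S.a - S.η / 2) (S.a + S.η / 2) → low (S.θ (t, x)) = S'.θ (t, low x)
  low'_flow : ∀ x t, S'.f x ∈ Ioo (S'.a - S'.η / 2) (S'.a + S'.η / 2) →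
    S'.f x + t ∈ Ioo (S'.a - S'.η / 2) (S'.a + S'.η / 2) → low' (S'.θ (t, x)) = S.θ (t, low' x)
  hfeet : ∀ y ∈ S.D.region S.ε S.γ (S.a - S.η / 4) S.ℓu, S.f y ∈ Ioo (S.a - S.η / 2) (S.a + S.η / 2) →
    S.D.chartMap S'.D y = low y
  hfeet' : ∀ y ∈ S'.D.region S'.ε S'.γ (S'.a - S'.η / 4) S'.ℓu, S'.f y ∈ Ioo (S'.a - S'.η / 2) (S'.a + S'.η / 2) →
    S'.D.chartMap S.D y = low' y

namespace HandlePair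

variable {J M M'} (P : HandlePair J M M')

/-- The level offset `σ = f' p' - f p`. [folklore] -/
def σ : ℝ := P.S'.f P.S'.p - P.S.f P.S.p

/-- (Bookkeeping.) [folklore] -/
theorem σ_def : P.σ = P.S'.f P.S'.p - P.S.f P.S.p := rfl

/-- **Swapping the two sides.** [folklore] -/
def swap : HandlePair J M' M where
  S := P.S'
  S' := P.S
  hk := P.hk.symm
  hr := P.hr.symm
  hε := by rw [P.hε]
  hγ := by rw [P.hγ]
  hη := by rw [P.hη]
  hδ := by rw [P.hδ]
  ha := by rw [P.ha]; ring
  hℓ₁ := by rw [P.hℓ₁]; ring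
  hℓ₂ := by rw [P.hℓ₂]; ring
  hℓu := by rw [P.hℓu]; ring
  low := P.low'
  low' := P.low
  low_smooth := P.low'_smooth
  low'_smooth := P.low_smooth
  apply_low := P.apply_low'
  apply_low' := P.apply_low
  low_below := P.low'_below
  low'_below := P.low_below
  low'_low := P.low_low'
  low_low' := P.low'_low
  low_flow := P.low'_flow
  low'_flow := P.low_flow
  hfeet := P.hfeet'
  hfeet' := P.hfeet

/-- (Bookkeeping.) [folklore] -/
@[simp] theorem swap_S : P.swap.S = P.S' := rfl
/-- (Bookkeeping.) [folklore] -/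
@[simp] theorem swap_S' : P.swap.S' = P.S := rfl
/-- (Bookkeeping.) [folklore] -/
@[simp] theorem swap_low : P.swap.low = P.low' := rfl
/-- (Bookkeeping.) [folklore] -/
@[simp] theorem swap_low' : P.swap.low' = P.low := rfl
/-- (Bookkeeping.) [folklore] -/
theorem swap_σ : P.swap.σ = -P.σ := by simp [σ, swap]

/-- The chart ball hypothesis of the second side at radius `3ε` of the first. [folklore] -/
theorem hball' : closedBall (P.S'.D.chart.extend J P.S'.p) (3 * P.S.ε) ⊆ (P.S'.D.chart.extend J).target := by
  rw [← P.hε]; exact P.S'.hball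

/-! ### The chart map and the regions -/

/-- The chart map carries `N` onto `N'` (points of the chart ball). [cite: MilnorHCobordism1965, proof of Thm. 3.13] -/
theorem chartMap_mem_N_iff {x : M} (hxs : x ∈ P.S.D.chart.source) (hx : ‖P.S.D.coord x‖ ≤ 3 * P.S.ε) :
    P.S.D.chartMap P.S'.D x ∈ P.S'.N ↔ x ∈ P.S.N := by
  have h := P.S.D.mem_region_chartMap_iff P.S'.D P.hball' P.hk (ε := P.S.ε) (γ := P.S.γ)
    (ℓl := P.S.a - P.S.η / 4) (ℓu := P.S.ℓu) hxs hx
  have e1 : P.S.a - P.S.η / 4 + (P.S'.f P.S'.p - P.S.f P.S.p) = P.S'.a - P.S'.η / 4 := by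
    rw [P.ha, P.hη]; ring
  have e2 : P.S.ℓu + (P.S'.f P.S'.p - P.S.f P.S.p) = P.S'.ℓu := by rw [P.hℓu]
  rw [e1, e2] at h
  change P.S.D.chartMap P.S'.D x ∈ P.S'.D.region P.S'.ε P.S'.γ (P.S'.a - P.S'.η / 4) P.S'.ℓu ↔
    x ∈ P.S.D.region P.S.ε P.S.γ (P.S.a - P.S.η / 4) P.S.ℓu
  rw [P.hε, P.hγ]
  exact h

/-- The chart map carries feet to feet. [cite: MilnorHCobordism1965, proof of Thm. 3.13] -/
theorem chartMap_mem_feet {y : M} (hy : y ∈ P.S.feet) : P.S.D.chartMap P.S'.D y ∈ P.S'.feet := by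
  have hyb := P.S.N_subset_cball hy.1
  refine ⟨(P.chartMap_mem_N_iff hyb.1 hyb.2.le).2 hy.1, ?_⟩
  rw [P.S.D.apply_chartMap P.S'.D P.hball' P.hk hyb.1 hyb.2.le, hy.2, P.ha]

/-- On the feet the lower correspondence is the chart map. [folklore] -/
theorem chartMap_eq_low_of_mem_feet {y : M} (hy : y ∈ P.S.feet) : P.S.D.chartMap P.S'.D y = P.low y :=
  P.hfeet y hy.1 (by rw [hy.2]; constructor <;> linarith [P.S.η_pos])

/-- **`low` carries feet to feet** (it is the chart map there). [folklore] -/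
theorem low_mem_feet {y : M} (hy : y ∈ P.S.feet) : P.low y ∈ P.S'.feet := by
  rw [← P.chartMap_eq_low_of_mem_feet hy]; exact P.chartMap_mem_feet hy

/-- **`low` carries non-feet of the level `a` to non-feet**: if `f y = a` and `low y ∈ F'` then
`y ∈ F` (`low` is injective below `a + η` and `F' = chartMap(F) = low(F)`). [folklore] -/
theorem mem_feet_of_low_mem_feet {y : M} (hya : P.S.f y = P.S.a) (hy : P.low y ∈ P.S'.feet) :
    y ∈ P.S.feet := by
  -- `low y = chartMap' ⁻¹`-image: pull back along the chart map of the second side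
  set y' := P.low y with hy'
  have hy'b := P.S'.N_subset_cball hy.1
  -- `y₀ := chartMap' y' ∈ F` and `low y₀ = chartMap y₀ = y'`
  set y₀ := P.S'.D.chartMap P.S.D y' with hy₀
  have hy₀F : y₀ ∈ P.S.feet := by
    have := P.swap.chartMap_mem_feet (y := y') hy
    exact this
  have hlow₀ : P.low y₀ = y' := by
    rw [← P.chartMap_eq_low_of_mem_feet hy₀F, hy₀]
    exact P.S'.D.chartMap_chartMap P.S.D (R := 3 * P.S.ε) P.S.hball hy'b.1 (by
      have := hy'b.2; rw [show (3 : ℝ) * P.S'.ε = 3 * P.S.ε by rw [P.hε]] at this; exact this.le)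
  -- injectivity of `low`
  have h1 : P.low' (P.low y₀) = y₀ := P.low'_low y₀ (by rw [hy₀F.2]; linarith [P.S.η_pos])
  have h2 : P.low' (P.low y) = y := P.low'_low y (by rw [hya]; linarith [P.S.η_pos])
  rw [hlow₀] at h1
  rw [← hy'] at h2
  rw [← h2, h1]
  exact hy₀F

/-- **The chart map conjugates the flows along orbits from the feet**: for `y ∈ F` and
`0 ≤ t ≤ ℓ⁺ - a`, `chartMap (θ (t, y)) = θ' (t, low y)`. [cite: MilnorHCobordism1965, proof of Thm. 3.13 (PDF pp. 18–19)] -/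
theorem chartMap_flow_of_mem_feet [T2Space M'] {y : M}
    (hy : y ∈ P.S.feet) {t : ℝ} (ht : t ∈ Icc 0 (P.S.ℓu - P.S.a)) :
    P.S.D.chartMap P.S'.D (P.S.θ (t, y)) = P.S'.θ (t, P.low y) := by
  rw [← P.chartMap_eq_low_of_mem_feet hy]
  exact P.S.isFlowOf.chartMap_apply_eq P.S'.isFlowOf (P.S'.hX.of_le (by norm_num))
    P.S.D P.S'.D P.hball' P.hk P.hr le_rfl (by linarith [P.S.a_lt_ℓu])
    (fun τ hτ => P.S.N_subset_cball (P.S.flow_mem_N_of_mem_feet hy hτ)) ht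

/-! ### Relations between the parameters of the two sides -/

/-- (Bookkeeping.) [folklore] -/
theorem a' : P.S'.a = P.S.a + P.σ := P.ha
/-- (Bookkeeping.) [folklore] -/
theorem ℓu' : P.S'.ℓu = P.S.ℓu + P.σ := P.hℓu
/-- (Bookkeeping.) [folklore] -/
theorem ℓ₁' : P.S'.ℓ₁ = P.S.ℓ₁ + P.σ := P.hℓ₁
/-- (Bookkeeping.) [folklore] -/
theorem ℓ₂' : P.S'.ℓ₂ = P.S.ℓ₂ + P.σ := P.hℓ₂
/-- (Bookkeeping.) [folklore] -/
theorem η' : P.S'.η = P.S.η := P.hη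

/-- **Backward levels** `f z - t ≤ f (θ (-t, z)) ≤ f z`. [cite: MilnorHCobordism1965, proof of Thm. 3.4 (PDF p. 13)] -/
theorem _root_.Literature.Topology.FourManifolds.HandleSide.apply_neg_mem_Icc (S : HandleSide J M) {z : M}
    (hz : S.f z < S.ℓ₂) {T : ℝ} (hT : S.ℓ₁ < S.f z - T) {t : ℝ} (ht : t ∈ Icc 0 T) :
    S.f z - t ≤ S.f (S.θ (-t, z)) ∧ S.f (S.θ (-t, z)) ≤ S.f z :=
  S.isFlowOf.apply_neg_mem_Icc_of_speed_mem S.hf S.hspeed hz hT ht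

/-- **Forward flow at unit speed off the region**, from the backward lemma at the end point:
for `x ∉ N` with `a - η/4 ≤ f x`, `f x + t ≤ ℓ⁺`, `0 ≤ t`: `θ (t, x) ∉ N` and
`f (θ (t, x)) = f x + t`. [cite: MilnorHCobordism1965, proof of Thm. 3.4 (PDF p. 13)] -/
theorem _root_.Literature.Topology.FourManifolds.HandleSide.apply_eq_add (S : HandleSide J M) {x : M}
    (hx : x ∉ S.N) (hxl : S.a - S.η / 4 ≤ S.f x) {t : ℝ} (ht : 0 ≤ t) (hxt : S.f x + t ≤ S.ℓu) :
    S.θ (t, x) ∉ S.N ∧ S.f (S.θ (t, x)) = S.f x + t := by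
  -- levels along `[0, t]`
  have hlev : ∀ τ ∈ Icc 0 t, S.f x ≤ S.f (S.θ (τ, x)) ∧ S.f (S.θ (τ, x)) ≤ S.f x + τ := fun τ hτ =>
    S.apply_mem_Icc (by linarith [S.ℓ₁_lt_a, S.η_pos]) (T := t) (by linarith [S.hℓu]) hτ
  have hband : ∀ τ ∈ Icc 0 t, S.f (S.θ (τ, x)) ∈ Icc (S.a - S.η / 4) S.ℓu := fun τ hτ =>
    ⟨hxl.trans (hlev τ hτ).1, (hlev τ hτ).2.trans (by linarith [hτ.2])⟩
  have hiff := S.mem_N_iff hband (t := t) (t' := 0) ⟨ht, le_rfl⟩ ⟨le_rfl, ht⟩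
  rw [S.isFlowOf.map_zero] at hiff
  have hqN : S.θ (t, x) ∉ S.N := fun h => hx (hiff.1 h)
  refine ⟨hqN, ?_⟩
  -- unit speed backward from the end point
  have hq₁ : S.θ (t, x) ∉ S.N₁ := fun h => hqN (S.N₁_subset_N h)
  have h := S.apply_neg_eq_sub hq₁ (by linarith [(hlev t ⟨ht, le_rfl⟩).2]) ht
    (by linarith [(hlev t ⟨ht, le_rfl⟩).1, S.hℓ₁, S.η_pos, hxt]) (s := t) ⟨ht, le_rfl⟩
  rw [S.isFlowOf.map_neg_map] at h
  linarith [h.1]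

/-! ### The flow conjugation `Λ` above the cut level -/

/-- **The flow conjugation** `Λ x = θ' (f x - a, low (θ (a - f x, x)))`: flow down to the cut
level, cross by `low`, flow up the same time (Milnor 1965, proof of Thm. 3.13: "each integral
curve … is mapped to the corresponding integral curve"). [cite: MilnorHCobordism1965, proof of Thm. 3.13 (PDF pp. 18–19)] -/
def lam (x : M) : M' := P.S'.θ (P.S.f x - P.S.a, P.low (P.S.θ (P.S.a - P.S.f x, x)))

/-- **The foot of a point off the region is crossed to a point off the region of the other
side**, at the cut level, and off the feet there. [folklore] -/
theorem low_foot_spec {x : M} (hx : x ∉ P.S.N) (hxa : P.S.a ≤ P.S.f x) (hxu : P.S.f x ≤ P.S.ℓu) :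
    P.S'.f (P.low (P.S.θ (P.S.a - P.S.f x, x))) = P.S'.a ∧ P.low (P.S.θ (P.S.a - P.S.f x, x)) ∉ P.S'.N := by
  obtain ⟨hya, hyN⟩ := P.S.apply_foot_and_not_mem hx hxa hxu
  set y := P.S.θ (P.S.a - P.S.f x, x) with hy
  have hly : P.S'.f (P.low y) = P.S'.a := by
    rw [P.apply_low y (by rw [hya]; constructor <;> linarith [P.S.η_pos]), hya, P.ha]
  refine ⟨hly, fun hmem => hyN ?_⟩
  exact (P.mem_feet_of_low_mem_feet hya ⟨hmem, hly⟩).1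

/-- **`Λ` off the region**: for `x ∉ N` with `a ≤ f x ≤ ℓ⁺`, `Λ x ∉ N'`, `f' (Λ x) = f x + σ`,
and flowing `Λ x` back down for the time `f x - a` gives `low` of the foot of `x`.
[cite: MilnorHCobordism1965, proof of Thm. 3.13 (PDF pp. 18–19)] -/
theorem lam_spec {x : M} (hx : x ∉ P.S.N) (hxa : P.S.a ≤ P.S.f x) (hxu : P.S.f x ≤ P.S.ℓu) :
    P.lam x ∉ P.S'.N ∧ P.S'.f (P.lam x) = P.S.f x + P.σ ∧
      P.S'.θ (P.S.a - P.S.f x, P.lam x) = P.low (P.S.θ (P.S.a - P.S.f x, x)) := by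
  obtain ⟨hly, hlyN⟩ := P.low_foot_spec hx hxa hxu
  set y' := P.low (P.S.θ (P.S.a - P.S.f x, x)) with hy'
  set s := P.S.f x - P.S.a with hs
  have hs0 : 0 ≤ s := by linarith
  have hsu : P.S'.f y' + s ≤ P.S'.ℓu := by rw [hly, P.ha, P.hℓu]; linarith
  obtain ⟨hzN, hzf⟩ := P.S'.apply_eq_add hlyN (by rw [hly]; linarith [P.S'.η_pos]) hs0 hsu
  have hlam : P.lam x = P.S'.θ (s, y') := rfl
  refine ⟨by rw [hlam]; exact hzN, by rw [hlam, hzf, hly, P.ha]; simp only [σ]; ring, ?_⟩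
  rw [hlam, show P.S.a - P.S.f x = -s by ring, P.S'.isFlowOf.map_neg_map]

/-! ### The handle-extension map -/

/-- **The handle-extension map**: the chart map on the handle region `N`, the lower
correspondence `low` below the level `a + η/2`, and the flow conjugation `Λ` elsewhere.
[cite: MilnorHCobordism1965, proof of Thm. 3.13 (PDF pp. 18–19)] -/
def hetMap (x : M) : M' := by
  classical
  exact if x ∈ P.S.N then P.S.D.chartMap P.S'.D x
    else if P.S.f x < P.S.a + P.S.η / 2 then P.low x else P.lam x

/-- (Bookkeeping.) [folklore] -/
theorem hetMap_of_mem {x : M} (hx : x ∈ P.S.N) : P.hetMap x = P.S.D.chartMap P.S'.D x := by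
  simp [hetMap, hx]

/-- (Bookkeeping.) [folklore] -/
theorem hetMap_of_lt {x : M} (hx : x ∉ P.S.N) (hlt : P.S.f x < P.S.a + P.S.η / 2) :
    P.hetMap x = P.low x := by
  simp [hetMap, hx, hlt]

/-- (Bookkeeping.) [folklore] -/
theorem hetMap_of_le {x : M} (hx : x ∉ P.S.N) (hle : P.S.a + P.S.η / 2 ≤ P.S.f x) :
    P.hetMap x = P.lam x := by
  simp [hetMap, hx, not_lt.2 hle]

/-- **`low` carries points off the region below `a + η/2` to points off the region of the other
side** (the key to the inverse in the lower branch). [folklore] -/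
theorem low_not_mem_N {x : M} (hx : x ∉ P.S.N) (hlt : P.S.f x < P.S.a + P.S.η / 2) :
    P.low x ∉ P.S'.N := by
  intro hw
  rcases lt_or_ge (P.S.f x) (P.S.a - P.S.η / 4) with hdeep | hsh
  · -- deep points go below the region
    have h1 := P.low_below x hdeep
    exact absurd hw.2.2.2.2.1 (not_le.2 h1)
  · have hband : P.S.f x ∈ Ioo (P.S.a - P.S.η / 2) (P.S.a + P.S.η / 2) :=
      ⟨by linarith [P.S.η_pos], hlt⟩
    have hfw := P.apply_low x hband
    rcases le_or_gt (P.S.f x) P.S.a with hbelow | habove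
    · -- `x` below the cut level: flow up to it
      set d := P.S.a - P.S.f x with hd
      have hd0 : 0 ≤ d := by linarith
      obtain ⟨hqN, hqf⟩ := P.S.apply_eq_add hx hsh hd0 (by linarith [P.S.a_lt_ℓu])
      have hqa : P.S.f (P.S.θ (d, x)) = P.S.a := by rw [hqf]; ring
      -- `low (θ (d, x)) ∉ N'`
      have hlq : P.low (P.S.θ (d, x)) ∉ P.S'.N := fun h =>
        hqN (P.mem_feet_of_low_mem_feet hqa ⟨h, by
          rw [P.apply_low _ (by rw [hqa]; constructor <;> linarith [P.S.η_pos]), hqa, P.ha]⟩).1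
      -- but it is `θ' (d, low x)`, in `N'` by invariance
      have hflow := P.low_flow x d hband (by rw [show P.S.f x + d = P.S.a by ring]; constructor <;> linarith [P.S.η_pos])
      rw [hflow] at hlq
      apply hlq
      have hlev : ∀ τ ∈ Icc 0 d, P.S'.f (P.S'.θ (τ, P.low x)) ∈ Icc (P.S'.a - P.S'.η / 4) P.S'.ℓu := by
        intro τ hτ
        have h := P.S'.apply_mem_Icc (z := P.low x) (by linarith [hfw, P.hℓ₁, P.S.ℓ₁_lt_a, P.S.η_pos])
          (T := d) (by linarith [hfw, P.hℓ₂, P.S.hℓu, P.S.a_lt_ℓu]) hτ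
        exact ⟨by linarith [h.1, hfw, P.ha, P.hη], by linarith [h.2, hτ.2, P.S.a_lt_ℓu, hfw, P.hℓu]⟩
      exact (P.S'.mem_N_iff hlev (t := d) (t' := 0) ⟨hd0, le_rfl⟩ ⟨le_rfl, hd0⟩).2
        (by rw [P.S'.isFlowOf.map_zero]; exact hw)
    · -- `x` above the cut level: flow down to it
      obtain ⟨hly, hlyN⟩ := P.low_foot_spec hx habove.le (by linarith [P.S.ha, P.S.δ_pos])
      set h := P.S.f x - P.S.a with hh
      have hh0 : 0 < h := by linarith
      have hflow := P.low_flow x (-h) hband (by rw [show P.S.f x + -h = P.S.a by ring]; constructor <;> linarith [P.S.η_pos])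
      rw [show P.S.a - P.S.f x = -h by ring, hflow] at hlyN
      apply hlyN
      have hlev : ∀ τ ∈ Icc (-h) 0, P.S'.f (P.S'.θ (τ, P.low x)) ∈ Icc (P.S'.a - P.S'.η / 4) P.S'.ℓu := by
        intro τ hτ
        have h1 := P.S'.apply_neg_mem_Icc (z := P.low x) (by linarith [hfw, P.hℓ₂, P.S.hℓu, P.S.ha, P.S.δ_pos, hlt])
          (T := h) (by linarith [hfw, P.hℓ₁, P.S.ℓ₁_lt_a, P.S.η_pos]) (t := -τ) ⟨by linarith [hτ.2], by linarith [hτ.1]⟩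
        rw [neg_neg] at h1
        exact ⟨by linarith [h1.1, hτ.1, hfw, P.ha, P.hη], by linarith [h1.2, P.S.ha, P.S.δ_pos, hfw, P.hℓu]⟩
      exact (P.S'.mem_N_iff hlev (t := -h) (t' := 0) ⟨le_rfl, by linarith⟩ ⟨by linarith, le_rfl⟩).2
        (by rw [P.S'.isFlowOf.map_zero]; exact hw)

/-- **Levels of the handle-extension map**: `f' (hetMap x) = f x + σ` for
`a - η/2 < f x ≤ ℓ⁺`. [cite: MilnorHCobordism1965, proof of Thm. 3.13 (PDF pp. 18–19)] -/
theorem apply_hetMap {x : M} (hxl : P.S.a - P.S.η / 2 < P.S.f x) (hxu : P.S.f x ≤ P.S.ℓu) :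
    P.S'.f (P.hetMap x) = P.S.f x + P.σ := by
  by_cases hx : x ∈ P.S.N
  · rw [P.hetMap_of_mem hx]
    have hb := P.S.N_subset_cball hx
    exact P.S.D.apply_chartMap P.S'.D P.hball' P.hk hb.1 hb.2.le
  · by_cases hlt : P.S.f x < P.S.a + P.S.η / 2
    · rw [P.hetMap_of_lt hx hlt]
      exact P.apply_low x ⟨hxl, hlt⟩
    · rw [P.hetMap_of_le hx (not_lt.1 hlt)]
      exact (P.lam_spec hx (by linarith [P.S.η_pos]) hxu).2.1

/-- The handle-extension map does not raise levels by more than `σ` (below `ℓ⁺`): for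
`f x ≤ b` with `a ≤ b ≤ ℓ⁺`, `f' (hetMap x) ≤ b + σ`. [folklore] -/
theorem apply_hetMap_le {b : ℝ} (hab : P.S.a ≤ b) (hb : b ≤ P.S.ℓu) {x : M} (hx : P.S.f x ≤ b) :
    P.S'.f (P.hetMap x) ≤ b + P.σ := by
  rcases lt_or_ge (P.S.a - P.S.η / 2) (P.S.f x) with h | h
  · rw [P.apply_hetMap h (hx.trans hb)]; linarith
  · -- deep points: `x ∉ N` (levels of `N` are `≥ a - η/4`) and `hetMap x = low x`
    have hxN : x ∉ P.S.N := fun hN => by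
      have := hN.2.2.2.2.1; linarith [P.S.η_pos]
    rw [P.hetMap_of_lt hxN (by linarith [P.S.η_pos])]
    have := P.low_below x (by linarith [P.S.η_pos])
    linarith [P.S'.η_pos, P.ha, P.σ_def]

/-- **The handle-extension maps of the pair and of the swapped pair are inverse to each other**
(on `{f ≤ ℓ⁺}`). [cite: MilnorHCobordism1965, proof of Thm. 3.13 (PDF pp. 18–19)] -/
theorem swap_hetMap_hetMap {x : M} (hxu : P.S.f x ≤ P.S.ℓu) : P.swap.hetMap (P.hetMap x) = x := by
  by_cases hx : x ∈ P.S.N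
  · -- the chart branch
    rw [P.hetMap_of_mem hx]
    have hb := P.S.N_subset_cball hx
    have hw : P.S.D.chartMap P.S'.D x ∈ P.S'.N := (P.chartMap_mem_N_iff hb.1 hb.2.le).2 hx
    rw [P.swap.hetMap_of_mem (by exact hw)]
    exact P.S.D.chartMap_chartMap P.S'.D P.hball' hb.1 hb.2.le
  · by_cases hlt : P.S.f x < P.S.a + P.S.η / 2
    · -- the lower branch
      rw [P.hetMap_of_lt hx hlt]
      have hwN := P.low_not_mem_N hx hlt
      have hwl : P.S'.f (P.low x) < P.S'.a + P.S'.η / 2 := by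
        rcases lt_or_ge (P.S.f x) (P.S.a - P.S.η / 4) with hdeep | hsh
        · have := P.low_below x hdeep; linarith [P.S'.η_pos]
        · rw [P.apply_low x ⟨by linarith [P.S.η_pos], hlt⟩, P.ha, P.hη]; linarith
      rw [P.swap.hetMap_of_lt (by exact hwN) (by exact hwl)]
      exact P.low'_low x hlt
    · -- the flow branch
      have hxa : P.S.a + P.S.η / 2 ≤ P.S.f x := not_lt.1 hlt
      rw [P.hetMap_of_le hx hxa]
      obtain ⟨hzN, hzf, hzflow⟩ := P.lam_spec hx (by linarith [P.S.η_pos]) hxu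
      have hza : P.S'.a + P.S'.η / 2 ≤ P.S'.f (P.lam x) := by linarith [hzf, P.ha, P.hη, P.σ_def]
      rw [P.swap.hetMap_of_le (by exact hzN) (by exact hza)]
      show P.S.θ (P.S'.f (P.lam x) - P.S'.a, P.low' (P.S'.θ (P.S'.a - P.S'.f (P.lam x), P.lam x))) = x
      have hs : P.S'.f (P.lam x) - P.S'.a = P.S.f x - P.S.a := by linarith [hzf, P.ha, P.σ_def]
      have hs' : P.S'.a - P.S'.f (P.lam x) = P.S.a - P.S.f x := by linarith [hs]
      have hya := (P.S.apply_foot_and_not_mem hx (by linarith [P.S.η_pos]) hxu).1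
      have hll : P.low' (P.low (P.S.θ (P.S.a - P.S.f x, x))) = P.S.θ (P.S.a - P.S.f x, x) :=
        P.low'_low _ (by rw [hya]; linarith [P.S.η_pos])
      rw [hs', hs, hzflow, hll, show P.S.a - P.S.f x = -(P.S.f x - P.S.a) by ring,
        P.S.isFlowOf.map_map_neg]

/-! ### Agreement of the three branches -/

/-- **On the region, off the half-constant region, the chart map is the flow conjugation**:
for `x ∈ N ∖ N₁` with `a < f x ≤ ℓ⁺`, `chartMap x = Λ x` (the backward orbit runs at unit speed
inside `N` down to a foot, from which the chart map conjugates the flows).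
[cite: MilnorHCobordism1965, proof of Thm. 3.13 (PDF pp. 18–19)] -/
theorem chartMap_eq_lam [T2Space M'] {x : M} (hxN : x ∈ P.S.N) (hx₁ : x ∉ P.S.N₁)
    (hxa : P.S.a < P.S.f x) (hxu : P.S.f x ≤ P.S.ℓu) : P.S.D.chartMap P.S'.D x = P.lam x := by
  set s := P.S.f x - P.S.a with hs
  have hs0 : 0 < s := by linarith
  have hT₁ : P.S.ℓ₁ < P.S.f x - s := by linarith [P.S.ℓ₁_lt_a, P.S.η_pos]
  have hlev : ∀ τ ∈ Icc 0 s, P.S.f (P.S.θ (-τ, x)) = P.S.f x - τ := fun τ hτ =>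
    (P.S.apply_neg_eq_sub hx₁ hxu hs0.le hT₁ hτ).1
  -- the foot `y = θ (-s, x)` is a foot of the handle
  have hya : P.S.f (P.S.θ (-s, x)) = P.S.a := by rw [hlev s ⟨hs0.le, le_rfl⟩]; ring
  have hband : ∀ t ∈ Icc (-s) 0, P.S.f (P.S.θ (t, x)) ∈ Icc (P.S.a - P.S.η / 4) P.S.ℓu := by
    intro t ht
    have h2 := hlev (-t) ⟨by linarith [ht.2], by linarith [ht.1]⟩
    rw [neg_neg] at h2
    rw [h2]; constructor <;> linarith [ht.1, ht.2, P.S.η_pos]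
  have hyN : P.S.θ (-s, x) ∈ P.S.N :=
    (P.S.mem_N_iff hband (t := -s) (t' := 0) ⟨le_rfl, by linarith⟩ ⟨by linarith, le_rfl⟩).2
      (by rw [P.S.isFlowOf.map_zero]; exact hxN)
  have hflow := P.chartMap_flow_of_mem_feet ⟨hyN, hya⟩ (t := s) ⟨hs0.le, by linarith⟩
  rw [P.S.isFlowOf.map_map_neg] at hflow
  rw [hflow]
  show P.S'.θ (s, P.low (P.S.θ (-s, x))) = P.S'.θ (P.S.f x - P.S.a, P.low (P.S.θ (P.S.a - P.S.f x, x)))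
  rw [show P.S.a - P.S.f x = -s by ring]

/-- **Off the region, just above the cut level, the lower correspondence is the flow
conjugation**: for `x ∉ N` with `a ≤ f x < a + η/2`, `low x = Λ x`. [folklore] -/
theorem low_eq_lam {x : M} (hx : x ∉ P.S.N) (hxa : P.S.a ≤ P.S.f x) (hlt : P.S.f x < P.S.a + P.S.η / 2) :
    P.low x = P.lam x := by
  set s := P.S.f x - P.S.a with hs
  have hya := (P.S.apply_foot_and_not_mem hx hxa (by linarith [P.S.ha, P.S.δ_pos])).1
  have hflow := P.low_flow (P.S.θ (P.S.a - P.S.f x, x)) s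
    (by rw [hya]; constructor <;> linarith [P.S.η_pos]) (by rw [hya]; constructor <;> linarith [P.S.η_pos])
  rw [show P.S.a - P.S.f x = -s by ring, P.S.isFlowOf.map_map_neg] at hflow
  rw [hflow]
  show P.S'.θ (s, P.low (P.S.θ (-s, x))) = P.S'.θ (P.S.f x - P.S.a, P.low (P.S.θ (P.S.a - P.S.f x, x)))
  rw [show P.S.a - P.S.f x = -s by ring]

/-- **On the region near the cut level, the chart map is the lower correspondence** (the
thick feet hypothesis). [folklore] -/
theorem chartMap_eq_low {x : M} (hxN : x ∈ P.S.N) (hlt : P.S.f x < P.S.a + P.S.η / 2) :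
    P.S.D.chartMap P.S'.D x = P.low x :=
  P.hfeet x hxN ⟨by linarith [hxN.2.2.2.2.1, P.S.η_pos], hlt⟩

/-- Below `a + η/2` the handle-extension map is `low`. [folklore] -/
theorem hetMap_eq_low {x : M} (hlt : P.S.f x < P.S.a + P.S.η / 2) : P.hetMap x = P.low x := by
  by_cases hx : x ∈ P.S.N
  · rw [P.hetMap_of_mem hx, P.chartMap_eq_low hx hlt]
  · rw [P.hetMap_of_lt hx hlt]

/-! ### Smoothness -/

/-- **The flow conjugation is smooth** at every point whose foot lies below `a + η` (where
`low` is smooth): it is `θ' ∘ (f - a, low ∘ θ ∘ (a - f, id))`. [folklore] -/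
theorem contMDiffAt_lam {x : M} (hx : P.S.f (P.S.θ (P.S.a - P.S.f x, x)) < P.S.a + P.S.η) :
    ContMDiffAt J J ∞ P.lam x := by
  have hθ : ContMDiff (𝓘(ℝ, ℝ).prod J) J ∞ P.S.θ := P.S.flow.contMDiff
  have hθ' : ContMDiff (𝓘(ℝ, ℝ).prod J) J ∞ P.S'.θ := P.S'.flow.contMDiff
  have hfoot : ContMDiffAt J J ∞ (fun x => P.S.θ (P.S.a - P.S.f x, x)) x :=
    hθ.contMDiffAt.comp x ((contMDiffAt_const.sub P.S.hf.contMDiffAt).prodMk contMDiffAt_id)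
  have hlow : ContMDiffAt J J ∞ P.low (P.S.θ (P.S.a - P.S.f x, x)) :=
    P.low_smooth.contMDiffAt ((isOpen_lt P.S.hf.continuous continuous_const).mem_nhds hx)
  have hinner : ContMDiffAt J (𝓘(ℝ, ℝ).prod J) ∞
      (fun x => (P.S.f x - P.S.a, P.low (P.S.θ (P.S.a - P.S.f x, x)))) x :=
    (P.S.hf.contMDiffAt.sub contMDiffAt_const).prodMk (hlow.comp x hfoot)
  exact hθ'.contMDiffAt.comp x hinner

/-- **The handle-extension map is smooth below `ℓ⁺ - δ`**: it is `low` on `{f < a + η/2}`, the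
chart map on the interior of the region, and `Λ` on `{a < f < ℓ⁺ - δ}` off the small region —
three open sets covering `{f < ℓ⁺ - δ}` on which the branches agree. [cite: MilnorHCobordism1965, proof of Thm. 3.13 (PDF pp. 18–19)] -/
theorem contMDiffOn_hetMap [T2Space M'] : ContMDiffOn J J ∞ P.hetMap {x | P.S.f x < P.S.ℓu - P.S.δ} := by
  intro x hx'
  have hx : P.S.f x < P.S.ℓu - P.S.δ := hx'
  apply ContMDiffAt.contMDiffWithinAt
  by_cases hlt : P.S.f x < P.S.a + P.S.η / 2
  · -- the lower branch
    have hev : P.hetMap =ᶠ[𝓝 x] P.low := by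
      filter_upwards [(isOpen_lt P.S.hf.continuous continuous_const).mem_nhds hlt] with y hy
      exact P.hetMap_eq_low hy
    refine (P.low_smooth.contMDiffAt ?_).congr_of_eventuallyEq hev
    exact (isOpen_lt P.S.hf.continuous continuous_const).mem_nhds (by show P.S.f x < P.S.a + P.S.η; linarith [P.S.η_pos])
  · have hxa : P.S.a < P.S.f x := by linarith [P.S.η_pos, not_lt.1 hlt]
    by_cases hsm : x ∈ P.S.Nsm
    · -- the chart branch, on the interior of the region
      have hev : P.hetMap =ᶠ[𝓝 x] P.S.D.chartMap P.S'.D := by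
        filter_upwards [P.S.isOpen_Nint.mem_nhds (P.S.Nsm_subset_Nint hsm)] with y hy
        exact P.hetMap_of_mem (P.S.Nint_subset_N hy)
      refine (ContMDiffOn.contMDiffAt (P.S.D.contMDiffOn_chartMap P.S'.D P.hball') ?_).congr_of_eventuallyEq hev
      exact P.S.D.isOpen_cball.mem_nhds (P.S.N_subset_cball (P.S.Nint_subset_N (P.S.Nsm_subset_Nint hsm)))
    · -- the flow branch, off the small region
      have hU : IsOpen ({y : M | P.S.f y ∈ Ioo P.S.a (P.S.ℓu - P.S.δ)} \ P.S.Nsm) := by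
        exact (isOpen_Ioo.preimage P.S.hf.continuous).sdiff P.S.isClosed_region_small
      have hxU : x ∈ {y : M | P.S.f y ∈ Ioo P.S.a (P.S.ℓu - P.S.δ)} \ P.S.Nsm := ⟨⟨hxa, hx⟩, hsm⟩
      have heq : ∀ y ∈ {y : M | P.S.f y ∈ Ioo P.S.a (P.S.ℓu - P.S.δ)} \ P.S.Nsm, P.hetMap y = P.lam y := by
        rintro y ⟨⟨hya, hyu⟩, hys⟩
        by_cases hyN : y ∈ P.S.N
        · rw [P.hetMap_of_mem hyN]
          exact P.chartMap_eq_lam hyN (P.S.not_mem_N₁_of_not_mem_Nsm hys hya hyu) hya (by linarith [P.S.δ_pos])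
        · by_cases hylt : P.S.f y < P.S.a + P.S.η / 2
          · rw [P.hetMap_of_lt hyN hylt]; exact P.low_eq_lam hyN hya.le hylt
          · exact P.hetMap_of_le hyN (not_lt.1 hylt)
      have hev : P.hetMap =ᶠ[𝓝 x] P.lam := by
        filter_upwards [hU.mem_nhds hxU] with y hy
        exact heq y hy
      refine (P.contMDiffAt_lam ?_).congr_of_eventuallyEq hev
      -- the foot of `x` is at level `a`
      by_cases hxN : x ∈ P.S.N
      · have hx₁ := P.S.not_mem_N₁_of_not_mem_Nsm hsm hxa hx
        have h := (P.S.apply_neg_eq_sub hx₁ (by linarith [P.S.δ_pos]) (T := P.S.f x - P.S.a) (by linarith)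
          (by linarith [P.S.ℓ₁_lt_a, P.S.η_pos]) (s := P.S.f x - P.S.a) ⟨by linarith, le_rfl⟩).1
        rw [show -(P.S.f x - P.S.a) = P.S.a - P.S.f x by ring] at h
        rw [h]; linarith [P.S.η_pos]
      · rw [(P.S.apply_foot_and_not_mem hxN hxa.le (by linarith [P.S.δ_pos])).1]; linarith [P.S.η_pos]

end HandlePair

end Literature.Topology.FourManifolds
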